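import Summits.QuantumFields.YangMills.Theorems.AllWindowsColdBoxDirichletCombBounds

/-!
# LINE-17 of crux `BoxMidWindowsSU22` (stmt-QuantumFields-24003), stub D `DirPoincareCubic` — part 2/3:
# the edge classes summed against the Dirichlet form, `Σ_e s(e)² ≤ 4000·H³·Σ_p circ(p)²`

Continuation of `Theorems/AllWindowsColdBoxDirichletCombBounds.lean` (same abstract setting `s : ZdEdge 4 → ℝ`, `hout`, `hforest`).
* `sum_family_le` — every injectively parametrised family of temporal plaquettes has total squared circulation at most the
  Dirichlet form `F = Σ_{q ∈ shift(dirCorner)(plaquettesIn {0..2H+2}⁴)} circ(q)²` (a temporal plaquette with non-zero circulation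
  lies in the enlarged box `{−1,…,2H+1}⁴`: `base_bounds_of_sCirc_ne_zero`, `mem_image_shift_of_base_bounds`);
* `sum_Phi_le`, `sum_strip_le`, `sum_PhiCol_le`, `sum_row_le` — the families occurring in the comb bounds are `≤ F`, `≤ 6F`, …;
* `classA_le` … `classD_le` — the four edge classes (bottom temporal, bottom spatial, temporal at height `≥ 1`, spatial at height
  `≥ 1`) of the cold box: `≤ 3(2H+1)²(2+39(2H+1))F`, `≤ 3F`, `≤ 6F`, `≤ 234H(2H+1)F`;
* `sum_boxEdges_le_sum_cons` — the box edges reindexed by `(t, z, i)`;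
* `sum_sq_boxEdges_le` — **the abstract ℓ² forest Poincaré inequality** `Σ_{e ∈ boxEdges 4 (2H+1)} s(e)² ≤ 4000·H³·F` (`H ≥ 1`).
Everything proved, no definition, standard axioms.  HONEST LABEL: glue obligation of a critic-passed line on the R2ξ″ RECORD-rung
crux 24003; no crux, rung or summit is proved; the Clay Yang–Mills mass gap is NOT proved by any of this.
-/

set_option autoImplicit false

noncomputable section

open Finset
open scoped Matrix
open Literature.Probability.LatticeModels (Site mem_halfOpenBox halfOpenBox)
open Literature.MathematicalPhysics.QuantumFieldTheory
open Literature.MathematicalPhysics.QuantumFieldTheory.LatticeMaxwell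
open Literature.MathematicalPhysics.QuantumFieldTheory.AxialGauge

namespace Summit.QuantumFields.YangMills.Theorems.AllWindowsColdBox.DirPoincare

open Summit.QuantumFields.YangMills.Theorems.WeakCouplingRates

section Config

variable {H : ℕ} (s : Literature.MathematicalPhysics.QuantumLattice.ZdEdge 4 → ℝ)
  (hout : ∀ e, e ∉ boxEdges 4 (2 * H + 1) → s e = 0)
  (hforest : ∀ x : Site 4, (∀ k : Fin 4, 1 ≤ x k ∧ x k + 1 ≤ 2 * (H : ℤ)) → s (x, 0) = 0)

/-! ## The plaquettes of the enlarged box and the family bounds -/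

include hout in
/-- If an edge value is non-zero, its base point lies in the cold box `{0,…,2H}⁴`. -/
theorem base_mem_of_ne_zero {b : Site 4} {i : Fin 4} (h : s (b, i) ≠ 0) : ∀ k, 0 ≤ b k ∧ b k ≤ 2 * (H : ℤ) := by
  have hm : (b, i) ∈ boxEdges 4 (2 * H + 1) := by
    by_contra hm; exact h (hout _ hm)
  intro k
  have := (mem_boxEdges_iff.1 hm).1 k
  push_cast at this
  omega

include hout in
/-- A temporal plaquette `(x; 0, j+1)` with non-zero circulation has its base point in `{−1,…,2H}⁴`. -/
theorem base_bounds_of_sCirc_ne_zero (x : Site 4) (j : Fin 3) (h : sCirc s (x, 0, j.succ) ≠ 0) :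
    ∀ k : Fin 4, -1 ≤ x k ∧ x k ≤ 2 * (H : ℤ) := by
  have hne : s (x, 0) ≠ 0 ∨ s (x + Pi.single (0 : Fin 4) 1, j.succ) ≠ 0 ∨
      s (x + Pi.single j.succ 1, 0) ≠ 0 ∨ s (x, j.succ) ≠ 0 := by
    by_contra hcon
    push Not at hcon
    obtain ⟨h1, h2, h3, h4⟩ := hcon
    apply h
    simp only [sCirc, h1, h2, h3, h4]; norm_num
  intro k
  rcases hne with hne | hne | hne | hne
  · have := base_mem_of_ne_zero s hout hne k; omega
  · have := base_mem_of_ne_zero s hout hne k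
    by_cases hk : k = 0
    · subst hk; simp at this; omega
    · simp [Pi.single_eq_of_ne hk] at this; omega
  · have := base_mem_of_ne_zero s hout hne k
    by_cases hk : k = j.succ
    · subst hk; simp at this; omega
    · simp [Pi.single_eq_of_ne hk] at this; omega
  · have := base_mem_of_ne_zero s hout hne k; omega

/-- A temporal plaquette whose base point lies in `{−1,…,2H}⁴` is a (translated) plaquette of the enlarged box. -/
theorem mem_image_shift_of_base_bounds (x : Site 4) (j : Fin 3) (hx : ∀ k : Fin 4, -1 ≤ x k ∧ x k ≤ 2 * (H : ℤ)) :
    (x, (0 : Fin 4), j.succ) ∈ (plaquettesIn (halfOpenBox 4 (2 * H + 3))).image (Plaq.shift dirCorner) := by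
  refine Finset.mem_image.2 ⟨(x - dirCorner, (0 : Fin 4), j.succ), ?_, ?_⟩
  · rw [Plaq.mem_plaquettesIn]
    refine ⟨?_, Fin.succ_pos j, ?_, ?_, ?_⟩ <;> rw [mem_halfOpenBox] <;> intro k <;> have hk := hx k
    · simp [dirCorner]; omega
    · by_cases h0 : k = 0
      · subst h0; simp [dirCorner]; omega
      · simp [dirCorner, Pi.single_eq_of_ne h0]; omega
    · by_cases h0 : k = j.succ
      · subst h0; simp [dirCorner]; omega
      · simp [dirCorner, Pi.single_eq_of_ne h0]; omega
    · by_cases h0 : k = 0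
      · subst h0; simp [dirCorner]; omega
      · by_cases h1 : k = j.succ
        · subst h1; simp [dirCorner]; omega
        · simp [dirCorner, Pi.single_eq_of_ne h0, Pi.single_eq_of_ne h1]; omega
  · simp [Plaq.shift]

include hout in
/-- **Family bound.**  Every injectively parametrised family of temporal plaquettes in a fixed plane `(0, j+1)` has total
squared circulation at most the Dirichlet form of the enlarged box (circulations vanish off the box). -/
theorem sum_family_le {κ : Type*} (A : Finset κ) (τ : κ → ℤ) (ω : κ → (Fin 3 → ℤ)) (j : Fin 3)
    (hinj : Set.InjOn (fun a => (τ a, ω a)) A) :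
    ∑ a ∈ A, sCirc s (Fin.cons (τ a) (ω a), 0, j.succ) ^ 2 ≤
      ∑ q ∈ (plaquettesIn (halfOpenBox 4 (2 * H + 3))).image (Plaq.shift dirCorner), sCirc s q ^ 2 := by
  classical
  set PB := (plaquettesIn (halfOpenBox 4 (2 * H + 3))).image (Plaq.shift dirCorner) with hPB
  set φ : κ → Plaq 4 := fun a => (Fin.cons (τ a) (ω a), 0, j.succ) with hφ
  have hφinj : Set.InjOn φ A := by
    intro a ha b hb hab
    simp only [hφ, Prod.mk.injEq] at hab
    have h2 := cons_inj2 hab.1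
    exact hinj ha hb (Prod.ext h2.1 h2.2)
  have h1 : ∑ a ∈ A, sCirc s (Fin.cons (τ a) (ω a), 0, j.succ) ^ 2 = ∑ q ∈ A.image φ, sCirc s q ^ 2 := by
    rw [Finset.sum_image hφinj]
  rw [h1]
  -- drop the plaquettes with zero circulation, the rest lie in `PB`
  have h2 : ∑ q ∈ A.image φ, sCirc s q ^ 2 = ∑ q ∈ (A.image φ).filter (· ∈ PB), sCirc s q ^ 2 := by
    rw [Finset.sum_filter]
    refine Finset.sum_congr rfl fun q hq => ?_
    split_ifs with hmem
    · rfl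
    · obtain ⟨a, -, rfl⟩ := Finset.mem_image.1 hq
      have : sCirc s (φ a) = 0 := by
        by_contra hne
        exact hmem (mem_image_shift_of_base_bounds (Fin.cons (τ a) (ω a)) j
          (base_bounds_of_sCirc_ne_zero s hout _ j hne))
      rw [this]; ring
  rw [h2]
  exact Finset.sum_le_sum_of_subset_of_nonneg (fun q hq => (Finset.mem_filter.1 hq).2) fun _ _ _ => by positivity

/-! ## Global sums: the edge classes against the Dirichlet form -/

section Global

variable (Φ : ℤ → (Fin 3 → ℤ) → ℝ)
  (hΦdef : ∀ t z, Φ t z = ∑ j : Fin 3, (sCirc s (Fin.cons t (z - Pi.single j 1), 0, j.succ) ^ 2 +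
    sCirc s (Fin.cons t z, 0, j.succ) ^ 2))
  (F : ℝ) (hFdef : F = ∑ q ∈ (plaquettesIn (halfOpenBox 4 (2 * H + 3))).image (Plaq.shift dirCorner), sCirc s q ^ 2)

include hΦdef in
/-- The face-plaquette majorant is non-negative. -/
theorem Phi_nonneg (t : ℤ) (z : Fin 3 → ℤ) : 0 ≤ Φ t z := by
  rw [hΦdef]; exact Finset.sum_nonneg fun _ _ => by positivity

include hFdef in
/-- The Dirichlet form is non-negative. -/
theorem F_nonneg : 0 ≤ F := by
  rw [hFdef]; exact Finset.sum_nonneg fun _ _ => by positivity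

include hout hΦdef hFdef in
/-- The face-plaquette bound `Φ` summed over any injectively parametrised family of columns is `≤ 6F`. -/
theorem sum_Phi_le {κ : Type*} (A : Finset κ) (τ : κ → ℤ) (ω : κ → (Fin 3 → ℤ))
    (hinj : Set.InjOn (fun a => (τ a, ω a)) A) : ∑ a ∈ A, Φ (τ a) (ω a) ≤ 6 * F := by
  simp only [hΦdef]
  rw [Finset.sum_comm]
  have hj : ∀ j : Fin 3, ∑ a ∈ A, (sCirc s (Fin.cons (τ a) (ω a - Pi.single j 1), 0, j.succ) ^ 2 +
      sCirc s (Fin.cons (τ a) (ω a), 0, j.succ) ^ 2) ≤ 2 * F := by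
    intro j
    rw [Finset.sum_add_distrib]
    have h1 := sum_family_le s hout A τ (fun a => ω a - Pi.single j 1) j (by
      intro a ha b hb hab
      simp only [Prod.mk.injEq, sub_left_inj] at hab
      exact hinj ha hb (Prod.ext hab.1 hab.2))
    have h2 := sum_family_le s hout A τ ω j hinj
    rw [← hFdef] at h1 h2
    linarith
  calc ∑ j : Fin 3, ∑ a ∈ A, (sCirc s (Fin.cons (τ a) (ω a - Pi.single j 1), 0, j.succ) ^ 2 +
        sCirc s (Fin.cons (τ a) (ω a), 0, j.succ) ^ 2)
      ≤ ∑ _j : Fin 3, 2 * F := Finset.sum_le_sum fun j _ => hj j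
    _ = 6 * F := by simp; ring

include hout hFdef in
/-- A strip family (all heights `t' ∈ [1,2H]`, columns translated injectively) is `≤ F`. -/
theorem sum_strip_le (W : Finset (Fin 3 → ℤ)) (v : Fin 3 → ℤ) (j : Fin 3) :
    ∑ z ∈ W, ∑ t' ∈ Finset.Icc 1 (2 * H), sCirc s (Fin.cons (t' : ℤ) (z + v), 0, j.succ) ^ 2 ≤ F := by
  rw [← Finset.sum_product', hFdef]
  exact sum_family_le s hout (W ×ˢ Finset.Icc 1 (2 * H)) (fun a => (a.2 : ℤ)) (fun a => a.1 + v) j (by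
    intro a _ b _ hab
    simp only [Prod.mk.injEq, Nat.cast_inj, add_left_inj] at hab
    exact Prod.ext hab.2 hab.1)

include hout hΦdef hFdef in
/-- A column family of `Φ` (all heights `t' ∈ [1,2H]`, columns translated injectively) is `≤ 6F`. -/
theorem sum_PhiCol_le (W : Finset (Fin 3 → ℤ)) (v : Fin 3 → ℤ) :
    ∑ z ∈ W, ∑ t' ∈ Finset.Icc 1 (2 * H), Φ (t' : ℤ) (z + v) ≤ 6 * F := by
  rw [← Finset.sum_product']
  exact sum_Phi_le s hout Φ hΦdef F hFdef (W ×ˢ Finset.Icc 1 (2 * H)) (fun a => (a.2 : ℤ)) (fun a => a.1 + v) (by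
    intro a _ b _ hab
    simp only [Prod.mk.injEq, Nat.cast_inj, add_left_inj] at hab
    exact Prod.ext hab.2 hab.1)

include hout hFdef in
/-- A single-height family (columns translated injectively) is `≤ F`. -/
theorem sum_row_le (W : Finset (Fin 3 → ℤ)) (v : Fin 3 → ℤ) (t : ℤ) (j : Fin 3) :
    ∑ z ∈ W, sCirc s (Fin.cons t (z + v), 0, j.succ) ^ 2 ≤ F := by
  rw [hFdef]
  exact sum_family_le s hout W (fun _ => t) (fun z => z + v) j (by
    intro a _ b _ hab
    simp only [Prod.mk.injEq, add_left_inj, true_and] at hab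
    exact hab)

/-! ### The four edge classes -/

include hout hFdef in
/-- (b) bottom-face spatial edges: `Σ_z Σ_j s((0,z), j+1)² ≤ 3F`. -/
theorem classB_le (W : Finset (Fin 3 → ℤ)) :
    ∑ z ∈ W, ∑ j : Fin 3, s (Fin.cons 0 z, j.succ) ^ 2 ≤ 3 * F := by
  rw [Finset.sum_comm]
  have hj : ∀ j : Fin 3, ∑ z ∈ W, s (Fin.cons 0 z, j.succ) ^ 2 ≤ F := fun j => by
    have h := sum_row_le s hout F hFdef W 0 (-1) j
    simp only [add_zero] at h
    refine le_of_eq_of_le (Finset.sum_congr rfl fun z _ => ?_) h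
    rw [s_bottom_spatial_eq s hout z j]
  calc ∑ j : Fin 3, ∑ z ∈ W, s (Fin.cons 0 z, j.succ) ^ 2 ≤ ∑ _j : Fin 3, F := Finset.sum_le_sum fun j _ => hj j
    _ = 3 * F := by simp

include hout hforest hΦdef hFdef in
/-- (c) temporal edges at heights `t ∈ [1, 2H]`: `Σ_t Σ_z s((t,z), 0)² ≤ 6F`. -/
theorem classC_le (W : Finset (Fin 3 → ℤ)) :
    ∑ t ∈ Finset.Icc 1 (2 * H), ∑ z ∈ W, s (Fin.cons (t : ℤ) z, 0) ^ 2 ≤ 6 * F := by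
  have h := sum_PhiCol_le s hout Φ hΦdef F hFdef W 0
  simp only [add_zero] at h
  rw [Finset.sum_comm]
  refine le_trans (Finset.sum_le_sum fun z _ => Finset.sum_le_sum fun t ht => ?_) h
  rw [hΦdef]
  exact sq_temporal_le s hout hforest (t : ℤ) (by have := (Finset.mem_Icc.1 ht).1; exact_mod_cast this) z

include hout hforest hΦdef in
/-- The height-`≥ 1` spatial edge bound with the concrete `Φ`, for every translate. -/
theorem sq_spatial_le' (t : ℕ) (ht : 1 ≤ t) (y : Fin 3 → ℤ) (i : Fin 3) :
    s (Fin.cons (t : ℤ) y, i.succ) ^ 2 ≤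
      3 * (2 * H + 1) * (∑ t' ∈ Finset.Icc 1 (2 * H), sCirc s (Fin.cons (t' : ℤ) y, 0, i.succ) ^ 2 +
        ∑ t' ∈ Finset.Icc 1 (2 * H), Φ t' y + ∑ t' ∈ Finset.Icc 1 (2 * H), Φ t' (y + Pi.single i 1)) :=
  sq_spatial_le s hout Φ (Phi_nonneg s Φ hΦdef) (fun t ht z => by rw [hΦdef]; exact sq_temporal_le s hout hforest t ht z)
    t ht y i

include hout hΦdef hFdef in
/-- The spatial-edge majorant of direction `i+1`, summed over any translated column set: `≤ 13F`. -/
theorem sum_spatial_majorant_le (W : Finset (Fin 3 → ℤ)) (v : Fin 3 → ℤ) (i : Fin 3) :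
    ∑ z ∈ W, (∑ t' ∈ Finset.Icc 1 (2 * H), sCirc s (Fin.cons (t' : ℤ) (z + v), 0, i.succ) ^ 2 +
        ∑ t' ∈ Finset.Icc 1 (2 * H), Φ t' (z + v) + ∑ t' ∈ Finset.Icc 1 (2 * H), Φ t' (z + v + Pi.single i 1)) ≤
      13 * F := by
  rw [Finset.sum_add_distrib, Finset.sum_add_distrib]
  have h1 := sum_strip_le s hout F hFdef W v i
  have h2 := sum_PhiCol_le s hout Φ hΦdef F hFdef W v
  have h3 := sum_PhiCol_le s hout Φ hΦdef F hFdef W (v + Pi.single i 1)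
  simp only [← add_assoc] at h3
  linarith

include hout hforest hΦdef hFdef in
/-- (d) spatial edges at heights `t ∈ [1, 2H]`: `Σ_t Σ_z Σ_j s((t,z), j+1)² ≤ 2H · 3(2H+1) · 39 F`. -/
theorem classD_le (W : Finset (Fin 3 → ℤ)) :
    ∑ t ∈ Finset.Icc 1 (2 * H), ∑ z ∈ W, ∑ j : Fin 3, s (Fin.cons (t : ℤ) z, j.succ) ^ 2 ≤
      2 * H * (3 * (2 * H + 1)) * (39 * F) := by
  -- the majorant, independent of the height
  set M : ℝ := ∑ z ∈ W, ∑ j : Fin 3, 3 * (2 * H + 1) *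
    (∑ t' ∈ Finset.Icc 1 (2 * H), sCirc s (Fin.cons (t' : ℤ) z, 0, j.succ) ^ 2 +
      ∑ t' ∈ Finset.Icc 1 (2 * H), Φ t' z + ∑ t' ∈ Finset.Icc 1 (2 * H), Φ t' (z + Pi.single j 1)) with hM
  have hle : ∀ t ∈ Finset.Icc 1 (2 * H), ∑ z ∈ W, ∑ j : Fin 3, s (Fin.cons (t : ℤ) z, j.succ) ^ 2 ≤ M := by
    intro t ht
    exact Finset.sum_le_sum fun z _ => Finset.sum_le_sum fun j _ =>
      sq_spatial_le' s hout hforest Φ hΦdef t (Finset.mem_Icc.1 ht).1 z j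
  have hM_le : M ≤ 3 * (2 * H + 1) * (39 * F) := by
    have hsum : ∑ z ∈ W, ∑ j : Fin 3,
        (∑ t' ∈ Finset.Icc 1 (2 * H), sCirc s (Fin.cons (t' : ℤ) z, 0, j.succ) ^ 2 +
          ∑ t' ∈ Finset.Icc 1 (2 * H), Φ t' z + ∑ t' ∈ Finset.Icc 1 (2 * H), Φ t' (z + Pi.single j 1)) ≤ 39 * F := by
      rw [Finset.sum_comm]
      have hj : ∀ j : Fin 3, ∑ z ∈ W,
          (∑ t' ∈ Finset.Icc 1 (2 * H), sCirc s (Fin.cons (t' : ℤ) z, 0, j.succ) ^ 2 +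
            ∑ t' ∈ Finset.Icc 1 (2 * H), Φ t' z + ∑ t' ∈ Finset.Icc 1 (2 * H), Φ t' (z + Pi.single j 1)) ≤ 13 * F := by
        intro j
        have h := sum_spatial_majorant_le s hout Φ hΦdef F hFdef W 0 j
        simpa only [add_zero] using h
      calc _ ≤ ∑ _j : Fin 3, 13 * F := Finset.sum_le_sum fun j _ => hj j
        _ = 39 * F := by simp; ring
    have hpos : (0 : ℝ) ≤ 3 * (2 * H + 1) := by positivity
    calc M = 3 * (2 * H + 1) * ∑ z ∈ W, ∑ j : Fin 3,
          (∑ t' ∈ Finset.Icc 1 (2 * H), sCirc s (Fin.cons (t' : ℤ) z, 0, j.succ) ^ 2 +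
            ∑ t' ∈ Finset.Icc 1 (2 * H), Φ t' z + ∑ t' ∈ Finset.Icc 1 (2 * H), Φ t' (z + Pi.single j 1)) := by
          rw [hM, Finset.mul_sum]
          refine Finset.sum_congr rfl fun z _ => ?_
          rw [Finset.mul_sum]
      _ ≤ 3 * (2 * H + 1) * (39 * F) := mul_le_mul_of_nonneg_left hsum hpos
  calc ∑ t ∈ Finset.Icc 1 (2 * H), ∑ z ∈ W, ∑ j : Fin 3, s (Fin.cons (t : ℤ) z, j.succ) ^ 2
      ≤ ∑ _t ∈ Finset.Icc 1 (2 * H), M := Finset.sum_le_sum hle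
    _ = 2 * H * M := by
        rw [Finset.sum_const, Nat.card_Icc, nsmul_eq_mul]
        have : (2 * H + 1 - 1 : ℕ) = 2 * H := by omega
        rw [this]; push_cast; ring
    _ ≤ 2 * H * (3 * (2 * H + 1) * (39 * F)) := by
        have : (0 : ℝ) ≤ 2 * H := by positivity
        exact mul_le_mul_of_nonneg_left hM_le this
    _ = 2 * H * (3 * (2 * H + 1)) * (39 * F) := by ring

include hout hΦdef hFdef in
/-- One step of the bottom sweep, summed over a translated column set: `≤ 2F + 3(2H+1)·13F`. -/
theorem sweep_step_sum_le (W : Finset (Fin 3 → ℤ)) (v : Fin 3 → ℤ) :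
    ∑ z ∈ W, (sCirc s (Fin.cons 0 (z + v), 0, (0 : Fin 3).succ) ^ 2 +
        sCirc s (Fin.cons (-1) (z + v), 0, (0 : Fin 3).succ) ^ 2 +
        3 * (2 * H + 1) * (∑ t' ∈ Finset.Icc 1 (2 * H), sCirc s (Fin.cons (t' : ℤ) (z + v), 0, (0 : Fin 3).succ) ^ 2 +
          ∑ t' ∈ Finset.Icc 1 (2 * H), Φ t' (z + v) + ∑ t' ∈ Finset.Icc 1 (2 * H), Φ t' (z + v + Pi.single 0 1))) ≤
      2 * F + 3 * (2 * H + 1) * (13 * F) := by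
  rw [Finset.sum_add_distrib, Finset.sum_add_distrib]
  have h1 := sum_row_le s hout F hFdef W v 0 0
  have h2 := sum_row_le s hout F hFdef W v (-1) 0
  have h3 := sum_spatial_majorant_le s hout Φ hΦdef F hFdef W v 0
  have h4 : ∑ z ∈ W, 3 * (2 * H + 1) *
      (∑ t' ∈ Finset.Icc 1 (2 * H), sCirc s (Fin.cons (t' : ℤ) (z + v), 0, (0 : Fin 3).succ) ^ 2 +
        ∑ t' ∈ Finset.Icc 1 (2 * H), Φ t' (z + v) + ∑ t' ∈ Finset.Icc 1 (2 * H), Φ t' (z + v + Pi.single 0 1)) ≤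
      3 * (2 * H + 1) * (13 * F) := by
    rw [← Finset.mul_sum]
    exact mul_le_mul_of_nonneg_left h3 (by positivity)
  linarith

include hout hforest hΦdef in
/-- The per-edge bottom temporal bound with the concrete majorants. -/
theorem sq_bottom_temporal_le' (z : Fin 3 → ℤ) (hz : 0 ≤ z 0) :
    s (Fin.cons 0 z, 0) ^ 2 ≤ 3 * (2 * H + 1) * ∑ k ∈ Finset.range (2 * H + 1),
      (sCirc s (Fin.cons 0 (z + Pi.single 0 (k : ℤ)), 0, (0 : Fin 3).succ) ^ 2 +
        sCirc s (Fin.cons (-1) (z + Pi.single 0 (k : ℤ)), 0, (0 : Fin 3).succ) ^ 2 +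
        3 * (2 * H + 1) * (∑ t' ∈ Finset.Icc 1 (2 * H),
            sCirc s (Fin.cons (t' : ℤ) (z + Pi.single 0 (k : ℤ)), 0, (0 : Fin 3).succ) ^ 2 +
          ∑ t' ∈ Finset.Icc 1 (2 * H), Φ t' (z + Pi.single 0 (k : ℤ)) +
          ∑ t' ∈ Finset.Icc 1 (2 * H), Φ t' (z + Pi.single 0 (k : ℤ) + Pi.single 0 1))) := by
  have hΨ : ∀ w, s (Fin.cons 1 w, (0 : Fin 3).succ) ^ 2 ≤ (fun w => 3 * (2 * H + 1) *
      (∑ t' ∈ Finset.Icc 1 (2 * H), sCirc s (Fin.cons (t' : ℤ) w, 0, (0 : Fin 3).succ) ^ 2 +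
        ∑ t' ∈ Finset.Icc 1 (2 * H), Φ t' w + ∑ t' ∈ Finset.Icc 1 (2 * H), Φ t' (w + Pi.single 0 1))) w := by
    intro w
    have h := sq_spatial_le' s hout hforest Φ hΦdef 1 le_rfl w 0
    rw [Nat.cast_one] at h
    exact h
  have h := sq_bottom_temporal_le s hout _ hΨ z hz
  simp only at h
  exact h

include hout hforest hΦdef hFdef in
/-- (a) bottom temporal («Polyakov») edges: `Σ_{z ∈ {0..2H}³} s((0,z),0)² ≤ 3(2H+1)·(2H+1)·(2 + 39(2H+1))·F`. -/
theorem classA_le :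
    ∑ z ∈ halfOpenBox 3 (2 * H + 1), s (Fin.cons 0 z, 0) ^ 2 ≤
      3 * (2 * H + 1) * ((2 * H + 1) * (2 * F + 3 * (2 * H + 1) * (13 * F))) := by
  set W := halfOpenBox 3 (2 * H + 1) with hW
  have hz : ∀ z ∈ W, s (Fin.cons 0 z, 0) ^ 2 ≤ _ := fun z hzW =>
    sq_bottom_temporal_le' s hout hforest Φ hΦdef z ((mem_halfOpenBox.1 hzW) 0).1
  refine (Finset.sum_le_sum hz).trans ?_
  rw [← Finset.mul_sum, Finset.sum_comm]
  have hpos : (0 : ℝ) ≤ 3 * (2 * H + 1) := by positivity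
  refine (mul_le_mul_of_nonneg_left (Finset.sum_le_sum fun (k : ℕ) _ =>
    sweep_step_sum_le s hout Φ hΦdef F hFdef W (Pi.single 0 (k : ℤ))) hpos).trans ?_
  rw [Finset.sum_const, Finset.card_range, nsmul_eq_mul]; push_cast
  exact le_of_eq (by ring)

include hout hforest hΦdef hFdef in
/-- **The ℓ² forest Poincaré inequality, abstract form**: for every real edge configuration vanishing off the cold box
`{0,…,2H}⁴` and on the interior temporal forest, `Σ_e s(e)² ≤ 4000·H³·Σ_p circ(p)²`, the sum of squared circulations
running over the plaquettes of the enlarged box `{−1,…,2H+1}⁴` (`H ≥ 1`). -/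
theorem sum_sq_boxEdges_le (hH : 1 ≤ H) :
    ∑ e ∈ boxEdges 4 (2 * H + 1), s e ^ 2 ≤ 4000 * (H : ℝ) ^ 3 * F := by
  have hF0 : 0 ≤ F := F_nonneg s F hFdef
  set W := halfOpenBox 3 (2 * H + 1) with hW
  have h1 := sum_boxEdges_le_sum_cons (H := H) (fun e => s e ^ 2) (fun _ => by positivity)
  refine h1.trans ?_
  -- split off the bottom layer `t = 0` and the temporal direction `i = 0`
  have hsplit : ∑ t ∈ Finset.range (2 * H + 1), ∑ z ∈ W, ∑ i : Fin 4, s (Fin.cons (t : ℤ) z, i) ^ 2 =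
      (∑ z ∈ W, s (Fin.cons 0 z, 0) ^ 2 + ∑ z ∈ W, ∑ j : Fin 3, s (Fin.cons 0 z, j.succ) ^ 2) +
      (∑ t ∈ Finset.Icc 1 (2 * H), ∑ z ∈ W, s (Fin.cons (t : ℤ) z, 0) ^ 2 +
        ∑ t ∈ Finset.Icc 1 (2 * H), ∑ z ∈ W, ∑ j : Fin 3, s (Fin.cons (t : ℤ) z, j.succ) ^ 2) := by
    have hI : Finset.Ico 1 (2 * H + 1) = Finset.Icc 1 (2 * H) := Finset.Ico_succ_right_eq_Icc 1 (2 * H)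
    rw [Finset.range_eq_Ico, Finset.sum_eq_sum_Ico_succ_bot (by omega : 0 < 2 * H + 1), zero_add, hI]
    simp only [Fin.sum_univ_succ, Finset.sum_add_distrib, Nat.cast_zero]
  rw [hsplit]
  have hA := classA_le s hout hforest Φ hΦdef F hFdef
  have hB := classB_le s hout F hFdef W
  have hC := classC_le s hout hforest Φ hΦdef F hFdef W
  have hD := classD_le s hout hforest Φ hΦdef F hFdef W
  have hH' : (1 : ℝ) ≤ H := by exact_mod_cast hH
  have hnum : 3 * (2 * (H : ℝ) + 1) * ((2 * H + 1) * (2 * F + 3 * (2 * H + 1) * (13 * F))) + 3 * F +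
      (6 * F + 2 * H * (3 * (2 * H + 1)) * (39 * F)) ≤ 4000 * (H : ℝ) ^ 3 * F := by
    nlinarith [mul_nonneg (mul_nonneg hF0 (by positivity : (0:ℝ) ≤ H)) (by positivity : (0:ℝ) ≤ H),
      mul_nonneg hF0 (by positivity : (0:ℝ) ≤ H), hF0,
      mul_nonneg (mul_nonneg (mul_nonneg hF0 (by positivity : (0:ℝ) ≤ H)) (by positivity : (0:ℝ) ≤ H))
        (by linarith : (0:ℝ) ≤ H - 1),
      mul_nonneg (mul_nonneg hF0 (by positivity : (0:ℝ) ≤ H)) (by linarith : (0:ℝ) ≤ H - 1),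
      mul_nonneg hF0 (by linarith : (0:ℝ) ≤ H - 1)]
  linarith

end Global

end Config

end Summit.QuantumFields.YangMills.Theorems.AllWindowsColdBox.DirPoincare

end
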